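import Summits.ResolutionOfSingularities.ResolutionOfSingularities.Theorems.FrobeniusClosingSteerArithNearA
import HarnessLib

/-!
# Crux `Steer` (stmt-ResolutionOfSingularities-16345), β-leaf debt K-β0(a) — lemma (R) RET-ID, part 1: the RETURN IDENTITY
  (res-D-pv-053 g9; res-L0-w41-plan-1 RULING 317 (c); reader res-L0-w41-tri-1 g8; memo `D/res-D-pv-053/K-BETA0A-SCOPE.md` §4)

OURS (campaign `res-hironaka`, rung L ★L-G4, slot W4.1). Candidates' vocabulary made kernel; nothing here is a statement of H. Hironaka's manuscript
[Hironaka2017] (status: under review). AI-written; AI review is weaker than expert review. Def-free, Theses-free, 0 sorries.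

## What is proved (one visit pair of a σ_top-steered run, `p = 2`, characteristic `2`) — `ReturnId.returnIdentity`

Data: steered run, `R 0` dominated by `O`, regular members; a visit pair `(j, j′)` whose exceptional parameter `u` is ITSELF the odd divisor of the
B-stage `j` (a FREE RETURN: `HasClordAlongAt R s 2 j u 1`, cleaned order `d + 1` at `j`, `d` odd `≥ 3`), strip clause and N4's height-one clause
at `j′`. NO cone shape is assumed anywhere (e-free).
Conclusion: `R j′ = R (j+1)`; `u` is a regular parameter and a prime of `R j′`; there is a cleaner `g` at `j` with `f_j − g² = u·G₀`,
`G₀ ∈ 𝔪_j^d ∖ 𝔪_j^(d+1)` (re-cleaning along `u`: `…ArithNearA`'s `exists_sub_mul_sq_mem_pow`), whose weak transform `G₁ ∈ R j′` (`G₀ = u^d·G₁`)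
satisfies, for EVERY `h ∈ R j′`,
  `G₁ = W²·(f_{j′} − h²) + V²`  for some `V ∈ R j′` (`W` the unit of the visit law).
Proof: the visit law `s_{j′}·u^((d+1)/2)·W = s_j − G` squares to `u^(d+1)·(W² f′ − G₁) = (g + G)²`, so `W² f′ − G₁` is a square in the integrally
closed domain `R j′` (`ArithTransport.sq_of_pow_mul_eq_sq`), and `(Wh)² − S² = (Wh + S)²` in characteristic two.
READING (part 2, `…ArithReturnIdCone`): modulo `u`, in the polynomial local ring `R j′/(u) = κ_j[T]_𝔫`, squares have no odd-degree part, so the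
TOP-degree part of the dehomogenised `G₀`-cone equals `w̄²·` (the landing A-cone restricted to `U = 0`): the exceptional-free parts of the two cones
agree up to a unit — the number of variables does not drop across a free return.

[cite: Matsumura1987, Thm. 14.2] [folklore]
-/

noncomputable section

-- `Summit.<S>.<S>.…` duplicates the summit name by design (single-problem summit).
set_option linter.dupNamespace false

open IsLocalRing
open Literature.AlgebraicGeometry.Resolution
open Summit.ResolutionOfSingularities.ResolutionOfSingularities.Theorems.SwitchingDichotomy.Words

namespace Summit.ResolutionOfSingularities.ResolutionOfSingularities.Theorems.SwitchingDichotomy.ArithTransport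

namespace ReturnId

variable {K : Type} [Field K] [CharP K 2] {O : ValuationSubring K} {R : ℕ → Subring K} {P : (i : ℕ) → Ideal (R i)}
  {t : K} {s : ℕ → K}

/-- **Re-cleaning along the odd divisor.** In a local ring of characteristic two: `f − g₀² = u·c`, `u ∈ 𝔪 ∖ 𝔪²` (regular ring), cleaned order
`d + 1` with `d` odd ⇒ a cleaner `g` with `f − g² = u·G₀` and `G₀ ∈ 𝔪^d`. [folklore] -/
theorem exists_cleaner_cofactor_mem_pow {A : Type} [CommRing A] [IsRegularLocalRing A] [CharP A 2] {u f g₀ c : A}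
    (hu : u ∈ maximalIdeal A) (hu2 : u ∉ maximalIdeal A ^ 2) {d : ℕ} (hd : Odd d) (hc : f - g₀ ^ 2 = u * c)
    (hcl : ∃ g₁ : A, f - g₁ ^ 2 ∈ maximalIdeal A ^ (d + 1)) :
    ∃ g G₀ : A, f - g ^ 2 = u * G₀ ∧ G₀ ∈ maximalIdeal A ^ d := by
  obtain ⟨g₁, hg₁⟩ := hcl
  have h2 : (2 : A) = 0 := by exact_mod_cast CharP.cast_eq_zero A 2
  have hsum : u * c + (g₀ + g₁) ^ 2 ∈ maximalIdeal A ^ (d + 1) := by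
    have : u * c + (g₀ + g₁) ^ 2 = (f - g₁ ^ 2) + 2 * (g₀ * g₁ + g₁ ^ 2) - (f - g₀ ^ 2 - u * c) := by ring
    rw [this, h2, zero_mul, add_zero, hc, sub_self, sub_zero]
    exact hg₁
  obtain ⟨q, hq⟩ := NearA.exists_sub_mul_sq_mem_pow hu hu2 hd hsum
  refine ⟨g₀ + u * q, c - u * q ^ 2, ?_, hq⟩
  have : f - (g₀ + u * q) ^ 2 = (f - g₀ ^ 2) - u ^ 2 * q ^ 2 - 2 * (g₀ * u * q) := by ring
  rw [this, h2, zero_mul, sub_zero, hc]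
  ring

/-- **(R) RET-ID, part 1 — the RETURN IDENTITY.** See the module docstring. [folklore] -/
theorem returnIdentity (hrun : IsSteeredRun O R P t 2 s) (hR0 : SubringDominates (R 0) O.toSubring)
    (hreg : ∀ i, IsRegularLocalRing (R i)) {j j' : ℕ} (hvisit : IsVisitPair R P j j') {u : K}
    (hu : (∃ h : u ∈ R j, (⟨u, h⟩ : R j) ∈ P j) ∧ u ≠ 0 ∧ ∀ y : R j, y ∈ P j → O.valuation (y : K) ≤ O.valuation u)
    (Hγ : ∀ l, j < l → l < j' → ∃ hu : u ∈ R l, P l = Ideal.span {(⟨u, hu⟩ : R l)})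
    (h1 : ∀ (hs' : s j' ^ 2 ∈ R j') (Q : Ideal (R j')) [Q.IsPrime], Q.height = 1 →
      ¬ SigmaTopLegality.IsSingPrime (R j') 2 ⟨s j' ^ 2, hs'⟩ Q)
    {d : ℕ} (hd : Odd d) (h3 : 3 ≤ d) (hodd : HasClordAlongAt R s 2 j u 1) (hclj : HasCleanedOrderAt R s 2 j (d + 1)) :
    ∃ (_ : IsLocalRing (R j)) (_ : IsLocalRing (R j')) (_ : R j' = R (j + 1)) (hu' : u ∈ R j') (huj : u ∈ R j)
      (hsj : s j ^ 2 ∈ R j) (hsj' : s j' ^ 2 ∈ R j'),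
      (⟨u, hu'⟩ : R j') ∈ maximalIdeal (R j') ∧ (⟨u, hu'⟩ : R j') ∉ maximalIdeal (R j') ^ 2 ∧ Prime (⟨u, hu'⟩ : R j') ∧
      ∃ (g G₀ : R j) (G₁ W : R j'), IsUnit W ∧
        (⟨s j ^ 2, hsj⟩ : R j) - g ^ 2 = ⟨u, huj⟩ * G₀ ∧ G₀ ∈ maximalIdeal (R j) ^ d ∧ G₀ ∉ maximalIdeal (R j) ^ (d + 1) ∧
        ((G₀ : R j) : K) = u ^ d * (G₁ : K) ∧
        ∀ h : R j', ∃ V : R j', G₁ = W ^ 2 * ((⟨s j' ^ 2, hsj'⟩ : R j') - h ^ 2) + V ^ 2 := by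
  classical
  haveI hRloc : ∀ i, IsLocalRing (R i) := fun i => (hrun.2 i).1
  have hdom : ∀ i, SubringDominates (R i) O.toSubring := fun i => VisitLawPointStep.subringDominates_of_run hrun hR0 i
  have hbl : ∀ i, IsLocalBlowupAlong O (R i) (P i) (R (i + 1)) := fun i => (hrun.2 i).2.2.2.1
  have h2K : (2 : K) = 0 := CharTwo.two_eq_zero
  -- ### the point step `j` and its exceptional parameter
  obtain ⟨_, hPj⟩ := hvisit.2.1
  have hutrip := hu
  obtain ⟨⟨huR, huP⟩, hu0, humax⟩ := hu
  have hum : (⟨u, huR⟩ : R j) ∈ maximalIdeal (R j) := by rw [← hPj]; exact huP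
  have humax' : ∀ y : R j, y ∈ maximalIdeal (R j) → O.valuation (y : K) ≤ O.valuation u :=
    fun y hy => humax y (by rw [hPj]; exact hy)
  have hbl𝔪 : IsLocalBlowupAlong O (R j) (maximalIdeal (R j)) (R (j + 1)) := by rw [← hPj]; exact hbl j
  haveI hregj : IsRegularLocalRing (R j) := hreg j
  haveI hreg1 : IsRegularLocalRing (R (j + 1)) := hreg (j + 1)
  have hle : R j ≤ R (j + 1) := (hbl j).isLocalBlowup.le
  have hu1 : u ∈ R (j + 1) := hle huR
  obtain ⟨hum1, hu21, hprime1⟩ := VisitLawPointStep.prime_excParam_succ hrun hR0 hvisit.2.1 (hreg j) (hreg (j + 1)) hutrip hu1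
  have hu2j : (⟨u, huR⟩ : R j) ∉ maximalIdeal (R j) ^ 2 :=
    QuadraticStep.not_mem_sq_of_forall_valuation_le (hdom j) (u₀ := ⟨u, huR⟩) hu0 humax'
  -- ### the visit law (`ν = d + 1`)
  obtain ⟨⟨hRj', G, W, hG, hW, hWinv, hW0, hlaw⟩, -, -⟩ :=
    VisitLawDelta.visitLaw₂_of_run hrun hR0 hvisit hutrip Hγ hreg h1 (by omega : 2 ≤ d + 1) hclj
  have hsj : s j ^ 2 ∈ R j := VisitLawPointStep.pow_mem_of_run hrun j
  have hsj' : s j' ^ 2 ∈ R j' := VisitLawPointStep.pow_mem_of_run hrun j'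
  -- ### transport the `u`-facts to the index `j′`
  have key : ∀ (S : Subring K) (hS : S = R (j + 1)) [IsLocalRing S] (huS : u ∈ S),
      (⟨u, huS⟩ : S) ∈ maximalIdeal S ∧ (⟨u, huS⟩ : S) ∉ maximalIdeal S ^ 2 ∧ Prime (⟨u, huS⟩ : S) := by
    intro S hS _ huS
    subst hS
    exact ⟨hum1, hu21, hprime1⟩
  have hu' : u ∈ R j' := by rw [hRj']; exact hu1
  obtain ⟨hum', hu2', hprime'⟩ := key (R j') hRj' hu'
  haveI hregj' : IsRegularLocalRing (R j') := hreg j'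
  haveI := isDomain_of_isRegularLocalRing (R j')
  haveI := isIntegrallyClosed_of_isRegularLocalRing (R j')
  have hu0' : (⟨u, hu'⟩ : R j') ≠ 0 := fun h0 => hu0 (congrArg Subtype.val h0)
  -- ### re-clean along `u` at `j`: `f − g² = u·G₀`, `G₀ ∈ 𝔪^d ∖ 𝔪^(d+1)`
  obtain ⟨huj0, hsj0, ⟨g₀, hg₀⟩, -⟩ := hodd
  obtain ⟨c, hc⟩ := Ideal.mem_span_singleton'.mp hg₀
  obtain ⟨_, hsj1, hex1, hmax1⟩ := hclj
  have hsjeq0 : (⟨s j ^ 2, hsj0⟩ : R j) = ⟨s j ^ 2, hsj⟩ := Subtype.ext rfl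
  have hsjeq1 : (⟨s j ^ 2, hsj1⟩ : R j) = ⟨s j ^ 2, hsj⟩ := Subtype.ext rfl
  have hujeq : (⟨u, huj0⟩ : R j) = ⟨u, huR⟩ := Subtype.ext rfl
  rw [hsjeq0, hujeq, pow_one] at hc
  rw [hsjeq1] at hex1 hmax1
  obtain ⟨g, G₀, hgG₀, hG₀d⟩ := exists_cleaner_cofactor_mem_pow hum hu2j hd (f := (⟨s j ^ 2, hsj⟩ : R j))
    (by rw [← hc]; ring) hex1
  have hG₀not : G₀ ∉ maximalIdeal (R j) ^ (d + 1) := by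
    intro hmem
    apply hmax1 g
    rw [hgG₀, pow_succ']
    exact Ideal.mul_mem_mul hum hmem
  -- ### the weak transform `G₁`
  obtain ⟨w, hw, -⟩ := PointStepOrderBound.div_pow_not_mem_pow_succ_of_pointStep (hdom j) hbl𝔪 huR hum hu0 humax' hG₀d hG₀not
  have hwj' : (w : K) ∈ R j' := by rw [hRj']; exact w.2
  have hgK : ((g : R j) : K) ∈ R j' := by rw [hRj']; exact hle g.2
  -- ### the visit law squared: `u^(d+1) · (W² f′ − G₁) = (g + G)²`
  obtain ⟨e, rfl⟩ := hd
  have he : (2 * e + 1 + 1) / 2 = e + 1 := by omega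
  rw [he] at hlaw
  have hwK : (G₀ : K) = u ^ (2 * e + 1) * (w : K) := by rw [← hw]; ring
  have hfK : s j ^ 2 - ((g : R j) : K) ^ 2 = u * (G₀ : K) := by
    have := congrArg Subtype.val hgG₀
    push_cast at this
    exact this
  have hK : u ^ (2 * (e + 1)) * (W ^ 2 * s j' ^ 2 - (w : K)) = (G + ((g : R j) : K)) ^ 2 := by
    have hsq : (s j' * u ^ (e + 1) * W) ^ 2 = (s j - G) ^ 2 := by rw [hlaw]
    linear_combination hsq + hfK + u * hwK - (s j * G + G * ((g : R j) : K)) * h2K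
  have hRj : (⟨u, hu'⟩ : R j') ^ (2 * (e + 1)) * (⟨W, hW⟩ ^ 2 * ⟨s j' ^ 2, hsj'⟩ - ⟨(w : K), hwj'⟩) =
      ((⟨G, hG⟩ : R j') + ⟨((g : R j) : K), hgK⟩) ^ 2 := by
    apply Subtype.ext
    push_cast
    exact hK
  obtain ⟨S, hS⟩ := sq_of_pow_mul_eq_sq hu0' (e + 1) hRj
  have h2 : (2 : R j') = 0 := by exact_mod_cast CharP.cast_eq_zero (R j') 2
  have hWunit : IsUnit (⟨W, hW⟩ : R j') :=
    isUnit_iff_exists_inv.mpr ⟨⟨W⁻¹, hWinv⟩, Subtype.ext (by push_cast; exact mul_inv_cancel₀ hW0)⟩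
  refine ⟨hRloc j, hRloc j', hRj', hu', huR, hsj, hsj', hum', hu2', hprime', g, G₀, ⟨(w : K), hwj'⟩, ⟨W, hW⟩, hWunit, hgG₀, hG₀d,
    hG₀not, ?_, fun h => ⟨⟨W, hW⟩ * h + S, ?_⟩⟩
  · push_cast; exact hwK
  · have key2 : (⟨(w : K), hwj'⟩ : R j') = ⟨W, hW⟩ ^ 2 * (⟨s j' ^ 2, hsj'⟩ - h ^ 2) + (⟨W, hW⟩ * h + S) ^ 2
        - 2 * (⟨W, hW⟩ * h * S + S ^ 2) - ((⟨W, hW⟩ ^ 2 * ⟨s j' ^ 2, hsj'⟩ - ⟨(w : K), hwj'⟩) - S ^ 2) := by ring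
    rw [key2, h2, zero_mul, sub_zero, hS, sub_self, sub_zero]

end ReturnId

end Summit.ResolutionOfSingularities.ResolutionOfSingularities.Theorems.SwitchingDichotomy.ArithTransport

end
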